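import Literature.AlgebraicGeometry.Motives.AbelianVarietyTranslation
import Literature.AlgebraicGeometry.Motives.AbelianVarietyTheoremOfCubeProofs
import Literature.AlgebraicGeometry.Motives.CechComplexPseudoCoherentGeneralProofs
import HarnessLib

/-!
# The theorem of the square from the theorem of the cube (Görtz–Wedhorn II, Thm. 24.73 ⟹ Thm. 27.168)

`Motives/AbelianVarietyTranslation` records **the theorem of the square** for an abelian variety
`A` over a field `K` (Görtz–Wedhorn II, Thm. 27.168 in the form (27.30.2), at `T = S = Spec K` and
in divisor language: `t^*_{xy} D + D ∼ t^*_x D + t^*_y D` for `x, y ∈ A(K)`) as the named fact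
`AbelianVariety.theoremOfTheSquare A`, and proves it there from the cubical structure
(`theoremOfTheSquare_of_cubicalStructure`, the printed proof of Thm. 27.168 from Prop. 27.167).
`Motives/AbelianVarietyTheoremOfCube` proves the cubical structure from the Theorem of the Cube
(`AbelianVariety.cubicalStructure_linEquiv_of_theoremOfCube`, the printed proof of Prop. 27.167
from Thm. 24.73), and `Motives/AbelianVarietyTheoremOfCubeProofs` proves the Theorem of the Cube
from the seesaw theorem and its local form (`theoremOfCube_linEquiv_of_seesaw`: Thm. 24.66 (3),
Thm. 24.66, Lemma 24.72 + Künneth ⟹ Thm. 24.73; and `theoremOfCube_linEquiv_of_semicontinuity`,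
with Thm. 24.66 (3) itself reduced to the semicontinuity theorem 23.139 (2) in
`Motives/SeesawSemicontinuity`).

This file composes these proved reductions for the theorem of the square, so that its trust
base is visible in one statement, exactly as `Motives/AbelianVarietyTheoremOfCubeProofs` does for
the cubical structure and for `[n]^*D ∼ n² D`:

* `AbelianVariety.theoremOfTheSquare_of_theoremOfCube` — Thm. 24.73 (`theoremOfCube_linEquiv`)
  ⟹ Thm. 27.168;
* `AbelianVariety.theoremOfTheSquare_of_seesaw` — the three named facts of
  `Motives/SeesawTheorem` (`seesaw_isClosed_trivialLocus`, `seesaw_exists_linEquiv_classPullback`,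
  `theoremOfCube_isOpen_trivialLocus`) ⟹ Thm. 27.168;
* `AbelianVariety.theoremOfTheSquare_of_semicontinuity` — the same with Thm. 24.66 (3) replaced
  by Thm. 23.139 (2) (`semicontinuity_isClosed_sectionLocus`);
* `AbelianVariety.forall_theoremOfTheSquare_of_theoremOfCube` — the form
  `∀ A : AbelianVariety K, A.theoremOfTheSquare` consumed by
  `AbelianVariety.isProjectiveOver_of_theoremOfTheSquare` (`Motives/AbelianVarietyAmpleProofs`,
  Görtz–Wedhorn II, Prop. 27.174).

The discharge `theoremOfTheSquare_holds` is then `theoremOfTheSquare_of_theoremOfCube` applied to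
the discharge of `theoremOfCube_linEquiv` (coherent cohomology and base change for proper
morphisms, in progress in `Motives/Seesaw*`, `Motives/TheoremOfCube*`, `Motives/KunnethH1*`); no
other input is missing. Nothing here is new mathematics: the content is Görtz–Wedhorn's chain of
implications 24.73 ⟹ 27.167 ⟹ 27.168, each link already proved in the files cited.

* `AbelianVariety.theoremOfTheSquare_holds` — **the discharge**: with
  `cechComplex_pseudoCoherent_general_holds` (`Motives/CechComplexPseudoCoherentGeneralProofs`,
  Görtz–Wedhorn II, Thm. 23.133 / Cor. 23.135 for the Čech complex of `𝒪(D)`: finiteness of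
  coherent cohomology of proper morphisms via Chow's lemma and dévissage, plus noetherian
  approximation) landed, `theoremOfTheSquare_of_pseudoCoherent_general` closes the named fact
  `AbelianVariety.theoremOfTheSquare` unconditionally.

Mathlib searched (pin): no `Pic`, no theorem of the square / cube, no seesaw principle
(cf. `Motives/CartierDivisor`, `Motives/AbelianVarietyTheoremOfCube`). In this tree: the inline
composition `fun B => theoremOfTheSquare_of_cubicalStructure
(B.cubicalStructure_linEquiv_of_theoremOfCube hcube)` inside
`AbelianVariety.isProjectiveOver_of_theoremOfCube` (`Motives/AbelianVarietyAmpleProofs`), which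
`forall_theoremOfTheSquare_of_theoremOfCube` names.

## References

* U. Görtz, T. Wedhorn, *Algebraic Geometry II: Cohomology of Schemes*, Springer Spektrum (2023),
  doi:10.1007/978-3-658-43031-3: Thm. 23.139 (2), p. 482; Lemma 24.65, Thm. 24.66, Lemma 24.72,
  Thm. 24.73, pp. 542–550; Prop. 27.167 and Thm. 27.168 with (27.30.2), pp. 877–878 (read via the
  held copy). [GortzWedhorn2023]
* D. Mumford, *Abelian Varieties*, TIFR Studies in Mathematics 5, OUP (1970): §6, theorem of the
  cube and Cor. 4 (theorem of the square), p. 59. [MumfordAV1970]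
-/

universe u

open CategoryTheory AlgebraicGeometry

namespace Literature.AlgebraicGeometry.Motives

namespace AbelianVariety

variable {K : Type u} [Field K] (A : AbelianVariety K)

/-- **The theorem of the square from the Theorem of the Cube** (Görtz–Wedhorn II: Thm. 24.73 ⟹
Prop. 27.167, proof pp. 877–878, `cubicalStructure_linEquiv_of_theoremOfCube`; Prop. 27.167 ⟹
Thm. 27.168, proof p. 878, `theoremOfTheSquare_of_cubicalStructure`).
[cite: GortzWedhorn2023, Thm. 27.168, proof (p. 878)] -/
theorem theoremOfTheSquare_of_theoremOfCube (h : theoremOfCube_linEquiv.{u}) :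
    A.theoremOfTheSquare :=
  theoremOfTheSquare_of_cubicalStructure (A.cubicalStructure_linEquiv_of_theoremOfCube h)

/-- The theorem of the square for **every** abelian variety over `K` from the Theorem of the Cube
— the hypothesis of `AbelianVariety.isProjectiveOver_of_theoremOfTheSquare`
(`Motives/AbelianVarietyAmpleProofs`, Görtz–Wedhorn II, Prop. 27.174).
[cite: GortzWedhorn2023, Thm. 27.168, proof (p. 878)] -/
theorem forall_theoremOfTheSquare_of_theoremOfCube (h : theoremOfCube_linEquiv.{u}) :
    ∀ B : AbelianVariety K, B.theoremOfTheSquare :=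
  fun B => B.theoremOfTheSquare_of_theoremOfCube h

/-- **The theorem of the square from the seesaw facts** (Görtz–Wedhorn II, Thm. 24.66 (3),
Thm. 24.66 and Lemma 24.72 with the Künneth formula ⟹ Thm. 24.73, proof p. 550,
`theoremOfCube_linEquiv_of_seesaw`; ⟹ Prop. 27.167 ⟹ Thm. 27.168).
[cite: GortzWedhorn2023, Thm. 27.168, proof (p. 878)] -/
theorem theoremOfTheSquare_of_seesaw (hA : seesaw_isClosed_trivialLocus.{u})
    (hB : seesaw_exists_linEquiv_classPullback.{u}) (hC : theoremOfCube_isOpen_trivialLocus.{u}) :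
    A.theoremOfTheSquare :=
  A.theoremOfTheSquare_of_theoremOfCube (theoremOfCube_linEquiv_of_seesaw hA hB hC)

/-- **The theorem of the square from semicontinuity, seesaw and the local form of the theorem of
the cube** (Görtz–Wedhorn II, Thm. 23.139 (2) + Lemma 24.65 ⟹ Thm. 24.66 (3),
`seesaw_isClosed_trivialLocus_of_semicontinuity`; then as in `theoremOfTheSquare_of_seesaw`).
[cite: GortzWedhorn2023, Thm. 27.168, proof (p. 878)] -/
theorem theoremOfTheSquare_of_semicontinuity (hA : semicontinuity_isClosed_sectionLocus.{u})
    (hB : seesaw_exists_linEquiv_classPullback.{u}) (hC : theoremOfCube_isOpen_trivialLocus.{u}) :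
    A.theoremOfTheSquare :=
  A.theoremOfTheSquare_of_theoremOfCube (theoremOfCube_linEquiv_of_semicontinuity hA hB hC)

/-- **The theorem of the square from the pseudo-coherence of the Čech complex alone**
(Görtz–Wedhorn II, Thm. 23.133 / Cor. 23.135 ⟹ Thm. 24.66, Lemma 24.72, Thm. 24.73 ⟹
Prop. 27.167 ⟹ Thm. 27.168). With Step (I) of Lemma 24.72
(`theoremOfCube_trivialAlong_thickeningPt_holds`, `Motives/CubeStepI`) and the descent of the
fibre condition (`trivialLocus_descendsAlongStages_holds`, `Motives/TheoremOfCubeLimitProofs`)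
proved, the Theorem of the Cube rests on the single named fact
`cechComplex_pseudoCoherent_general` (`Motives/GrothendieckComplexSectionAlongCech`: the Čech
complex of `𝒪(D)` over an affine open of the base is pseudo-coherent — finiteness of coherent
cohomology of proper morphisms), via `theoremOfCube_linEquiv_of_pseudoCoherent_general`
(`Motives/AbelianVarietyTheoremOfCubeProofs`); hence so does the theorem of the square, and
`theoremOfTheSquare_holds` is this theorem applied to `cechComplex_pseudoCoherent_general_holds`.
[cite: GortzWedhorn2023, Thm. 27.168, proof (p. 878)] -/
theorem theoremOfTheSquare_of_pseudoCoherent_general (h : cechComplex_pseudoCoherent_general.{u}) :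
    A.theoremOfTheSquare :=
  A.theoremOfTheSquare_of_theoremOfCube (theoremOfCube_linEquiv_of_pseudoCoherent_general h)

/-- The theorem of the square for **every** abelian variety over `K` from the pseudo-coherence of
the Čech complex alone (the hypothesis of `AbelianVariety.isProjectiveOver_of_theoremOfTheSquare`,
`Motives/AbelianVarietyAmpleProofs`, Görtz–Wedhorn II, Prop. 27.174, from the one remaining named
fact). [cite: GortzWedhorn2023, Thm. 27.168, proof (p. 878)] -/
theorem forall_theoremOfTheSquare_of_pseudoCoherent_general
    (h : cechComplex_pseudoCoherent_general.{u}) : ∀ B : AbelianVariety K, B.theoremOfTheSquare :=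
  fun B => B.theoremOfTheSquare_of_pseudoCoherent_general h

/-- **The theorem of the square holds** (Görtz–Wedhorn II, Thm. 27.168 in the form (27.30.2) at
`T = S = Spec K`, in divisor language: for an abelian variety `A` over a field `K`, `x, y ∈ A(K)`
and a Cartier divisor `D` on `A`, `t^*_{x+y} D + D ∼ t^*_x D + t^*_y D`) — the discharge of the
named fact `AbelianVariety.theoremOfTheSquare` (`Motives/AbelianVarietyTranslation`). Proof: the
printed chain Thm. 23.133 / Cor. 23.135 (`cechComplex_pseudoCoherent_general_holds`,
`Motives/CechComplexPseudoCoherentGeneralProofs`) ⟹ Thm. 24.66, Lemma 24.72, Thm. 24.73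
(`theoremOfCube_linEquiv_of_pseudoCoherent_general`, `Motives/AbelianVarietyTheoremOfCubeProofs`)
⟹ Prop. 27.167 (`cubicalStructure_linEquiv_of_theoremOfCube`) ⟹ Thm. 27.168
(`theoremOfTheSquare_of_cubicalStructure`), composed in
`theoremOfTheSquare_of_pseudoCoherent_general`.
[cite: GortzWedhorn2023, Thm. 27.168 with (27.30.2), proof (pp. 877–878)] -/
theorem theoremOfTheSquare_holds : A.theoremOfTheSquare :=
  A.theoremOfTheSquare_of_pseudoCoherent_general cechComplex_pseudoCoherent_general_holds

end AbelianVariety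

end Literature.AlgebraicGeometry.Motives
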